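import Literature.Computation.Certificates.KeyedSparseStream
import Literature.Computation.Certificates.PackedGramCertificateRows
import Literature.Computation.Certificates.PsdRoundedTwin

/-!
# Gram entry streams: the free SOS block of a large identity in the «K-STREAM» lane

The Gram form `m(x)ᵀ Q m(x)` of ONE large exact Gram block (`s` basis monomials, `Q` rational with a
common denominator `L`) enters the kernel as a **certificate-sorted entry stream**: the entries
`(i, j, ±a_ij)` (`Q_ij = ±a_ij / L`, each unordered pair `i ≤ j` exactly once) sorted by the key
`key i + key j` of the product monomial `m_i m_j`, packed into `ℕ` numerals (`GramCtx`, `decode`,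
`entries`). Three kernel passes, each a single walk with `ℕ` arithmetic only:

* the **group-sum walk** of `KeyedSparseStream` (`groupCheck`) compares, key by key, the stream's
  contributions `mult(i,j) · (±a_ij) · x^{key i + key j}` (`terms`) with a key-sorted target;
* the **side pass** (`sidePass`) checks per entry: `i ≤ j < s`, the entry's position `π` is the one
  recorded in the position table at `(i, j)` and in the index tables at `π`, and the TWIN CLOSENESS
  `|S·a_ij·(±1) − L·(M_ij + s₂·[i=j])| ≤ L·e` against a low-height integer twin `M` read by random
  access (`getD2` + `bigDigit`) from the packed ROW numerals that ARE the data of the twin's own PSD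
  certificate (`PSD.Packed.checkRows` of `PackedGramCertificateRows`), so no consistency proof
  between two presentations of `M` is needed;
* the **pair pass** (`pairPass`) checks, for every pair `i ≤ j < s`, that the position table points
  at an entry whose recorded indices are `(i, j)`.

Side pass + pair pass make `π ↦ (i_π, j_π)` a bijection between stream positions and pairs
(two-sided inverse, no counting argument), so the stream IS a symmetric matrix `Qs` entry by entry,
its Gram terms sum to the quadratic form of that matrix at the monomial vector, and the closeness
entries are the hypothesis of the rounded-twin lemma `PSD.quadForm_nonneg_of_near`; with the
twin's `PSD.IsGramCertZ` this gives `0 ≤ Σ Gram terms` at every point — proved in the companions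
`KeyedGramStreamPasses` (semantics, bijection), `KeyedGramStreamSound` (twin bound, packed-rows
bridge) and `KeyedGramStreamWindows` (windowed main theorem `sum_eval_targets_ge`, kernel tests).
This file holds the DEFINITIONS the kernel evaluates.

Kind-1 entries (`Entry.tab`, an id decoded by a caller-supplied table function) pass through the
group-sum walk as contributions and are ignored by the Gram passes; the companion product-stream
file gives them meaning. [cite: BlekhermanParriloThomas2012, Thm 3.39]; twin perturbation
[cite: Rump1999VerifiedLargeSystems, §4 Algorithm 4.1 step 7]; packed digits [cite: Harvey2009, §3.1].

WHAT THIS FILE IS NOT: not a PSD test of `Q` itself (PSD comes from the twin `M`, certified by the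
packed rows lane, plus closeness); not an SOS DECISION procedure; the monomial basis is whatever
keys the certificate declares (their meaning as monomials is `Keyed.monoEval`); kernel timings
quoted anywhere are single farm runs.
-/
namespace Literature.Computation.Certificates

namespace SOS

namespace Keyed

open PSD


/-! ### Bit fields of packed numerals -/

/-- The low `w` bits: `x mod 2^w` (computed as a mask). [cite: Harvey2009, §3.1] -/
def lowBits (x w : ℕ) : ℕ := x &&& (2 ^ w - 1)

/-- `lowBits` is reduction modulo `2^w`. [cite: Harvey2009, §3.1] -/
theorem lowBits_eq (x w : ℕ) : lowBits x w = x % 2 ^ w := Nat.and_two_pow_sub_one_eq_mod x w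

/-- Digit `t` (width `w`) of a packed numeral: `(big >>> (w t)) mod 2^w` — the very expression of
`PSD.Packed.rowEntry`, so that twin rows are read identically by both lanes. [cite: Harvey2009, §3.1] -/
def bigDigit (w big t : ℕ) : ℕ := (big >>> (w * t)) % 2 ^ w

/-- Two-level table access: numeral number `t` of a table shipped as groups of `R` numerals
(`LL = [[n₀, …, n_{R-1}], [n_R, …], …]`), i.e. entry `t` of `LL.flatten`, reached in `≤ t/R + R` list
steps and WITHOUT materialising any large intermediate (each numeral is small: one matrix row, or a
few thousand table digits). Missing entries read `0`. [cite: Harvey2009, §3.1] -/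
def getD2 (LL : List (List ℕ)) (R t : ℕ) : ℕ := (LL.getD (t / R) []).getD (t % R) 0

/-! ### Stream context, entries, decoding -/

/-- **Stream context**: basis size `s`, field widths (`wi` bits per basis index, `wl` bits of the
length field of an inline magnitude, `wd` bits of a table id), and the packed key table (`wk` bits
per key; key `a` = the Kronecker code of basis monomial `m_a`). [cite: Harvey2009, §3.1] -/
structure GramCtx where
  /-- basis size -/
  s : ℕ
  /-- bits per basis index -/
  wi : ℕ
  /-- bits of the length field -/
  wl : ℕ
  /-- bits of a table-contribution id -/
  wd : ℕ
  /-- bits per key in the key table -/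
  wk : ℕ
  /-- the packed key table -/
  keys : ℕ

namespace GramCtx

/-- Key (Kronecker code) of basis monomial `a`. [folklore] -/
def key (c : GramCtx) (a : ℕ) : ℕ := bigDigit c.wk c.keys a

end GramCtx

/-- A decoded stream entry: a Gram entry `(i, j, ±mag)` (one term `Q_ij` of the coefficient matching
`p_α = Σ_{β+γ=α} Q_{βγ}`) or a table contribution id. [cite: BlekhermanParriloThomas2012, §3.1.4 eq. (3.12), p. 64] -/
inductive Entry where
  /-- Gram entry: pair `(i, j)`, sign (`true` = nonnegative) and magnitude of `L · Q_ij`. -/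
  | gram (i j : ℕ) (sg : Bool) (mag : ℕ)
  /-- Table contribution with the given id (meaning supplied by the caller). -/
  | tab (id : ℕ)
  deriving DecidableEq, Repr

/-- Decode ONE entry from the low end of a chunk numeral; returns the entry and the rest.
Layout (low to high bits): kind (2) — kind 0: `i` (wi) `j` (wi) sign (1) `len` (wl) `mag` (len);
other kinds: `id` (wd). [folklore] -/
def decode (c : GramCtx) (e : ℕ) : Entry × ℕ :=
  let kind := lowBits e 2
  let e := e >>> 2
  if kind = 0 then
    let i := lowBits e c.wi
    let e := e >>> c.wi
    let j := lowBits e c.wi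
    let e := e >>> c.wi
    let sg := lowBits e 1
    let e := e >>> 1
    let len := lowBits e c.wl
    let e := e >>> c.wl
    let mag := lowBits e len
    (Entry.gram i j (sg == 0) mag, e >>> len)
  else
    let id := lowBits e c.wd
    (Entry.tab id, e >>> c.wd)

/-- Decode `k` entries of one chunk. [folklore] -/
def entriesChunk (c : GramCtx) : ℕ → ℕ → List Entry
  | 0, _ => []
  | k + 1, e => let d := decode c e; d.1 :: entriesChunk c k d.2

/-- Decode a chunk list `[(count₀, numeral₀), …]`. [folklore] -/
def entries (c : GramCtx) : List (ℕ × ℕ) → List Entry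
  | [] => []
  | (cnt, e) :: rest => entriesChunk c cnt e ++ entries c rest

/-- Multiplicity of the pair `(i, j)` in the symmetric expansion: `1` on the diagonal, `2` off it
(each unordered pair is listed once). [folklore] -/
def mult (i j : ℕ) : ℕ := if i = j then 1 else 2

/-- The contribution of one entry as a sign–magnitude term; table ids through `tab`. [folklore] -/
def termOf (c : GramCtx) (tab : ℕ → ℕ × Bool × ℕ) : Entry → ℕ × Bool × ℕ
  | Entry.gram i j sg mag => (c.key i + c.key j, sg, mult i j * mag)
  | Entry.tab id => tab id

/-- Map the entries to terms (structurally, so that the kernel streams it). [folklore] -/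
def termsOf (c : GramCtx) (tab : ℕ → ℕ × Bool × ℕ) : List Entry → STerms
  | [] => []
  | en :: rest => termOf c tab en :: termsOf c tab rest

/-- **The contribution terms of a stream.** [folklore] -/
def terms (c : GramCtx) (tab : ℕ → ℕ × Bool × ℕ) (chunks : List (ℕ × ℕ)) : STerms :=
  termsOf c tab (entries c chunks)

/-! ### Packed key-sorted targets -/

/-- Decode `k` target terms `(key (wK bits), sign (1), len (wl), mag (len))` from one numeral.
[folklore] -/
def targetsChunk (wK wl : ℕ) : ℕ → ℕ → STerms
  | 0, _ => []
  | k + 1, e =>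
    let key := lowBits e wK
    let e := e >>> wK
    let sg := lowBits e 1
    let e := e >>> 1
    let len := lowBits e wl
    let e := e >>> wl
    let mag := lowBits e len
    (key, sg == 0, mag) :: targetsChunk wK wl k (e >>> len)

/-- Decode a packed target `[(count₀, numeral₀), …]`. [folklore] -/
def targets (wK wl : ℕ) : List (ℕ × ℕ) → STerms
  | [] => []
  | (cnt, e) :: rest => targetsChunk wK wl cnt e ++ targets wK wl rest

/-! ### The side pass (positions, index tables, twin closeness) -/

/-- **Twin closeness of one entry**, `|S·(±a) − L·(d − off + s₂·[diag])| ≤ L·e`, with `d` the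
offset digit of the twin entry, all in `ℕ` (split into nonnegative parts).
[cite: Rump1999VerifiedLargeSystems, §4 Algorithm 4.1 step 7] -/
def closeN (S L s₂ e off : ℕ) (diag : Bool) (sg : Bool) (a d : ℕ) : Bool :=
  let P := (if sg then S * a else 0) + L * off
  let N := (if sg then 0 else S * a) + L * (d + if diag then s₂ else 0)
  if N ≤ P then decide (P - N ≤ L * e) else decide (N - P ≤ L * e)

/-- **Twin/table data for the side pass.** The twin `M` as packed ROW numerals (`wm`-bit digits
with offset `2^(wm-1)` — exactly the `Arows` format of the packed rows PSD lane
`PSD.Packed.checkRows`, so the twin's PSD certificate and this pass read the same list), shipped in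
groups of `R` rows (`Mrows`, read by `getD2`); the position table likewise (`Prows`, `wp`-bit digits,
row `i` holds the stream positions of the pairs `(i, j)`); the index tables `Itab`, `Jtab` (`wi`-bit
digits, `G` stream positions per numeral, numerals in groups of `R`); and the closeness constants.
[cite: Harvey2009, §3.1] -/
structure SideCtx where
  /-- rows per group (all grouped tables) -/
  R : ℕ
  /-- bits per twin digit -/
  wm : ℕ
  /-- twin rows, grouped -/
  Mrows : List (List ℕ)
  /-- bits per position digit -/
  wp : ℕ
  /-- position-table rows, grouped -/
  Prows : List (List ℕ)
  /-- stream positions per index-table numeral -/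
  G : ℕ
  /-- first indices by stream position, grouped numerals -/
  Itab : List (List ℕ)
  /-- second indices by stream position, grouped numerals -/
  Jtab : List (List ℕ)
  /-- twin scale `S` -/
  S : ℕ
  /-- common denominator `L` of the Gram entries -/
  L : ℕ
  /-- twin shift `s₂` -/
  s₂ : ℕ
  /-- closeness radius `e` -/
  e : ℕ

namespace SideCtx

/-- Twin offset digit at `(i, j)`. [cite: Harvey2009, §3.1] -/
def mAt (d : SideCtx) (i j : ℕ) : ℕ := bigDigit d.wm (getD2 d.Mrows d.R i) j

/-- Recorded stream position of the pair `(i, j)`. [cite: Harvey2009, §3.1] -/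
def posAt (d : SideCtx) (i j : ℕ) : ℕ := bigDigit d.wp (getD2 d.Prows d.R i) j

/-- Recorded first index of the entry at stream position `π`. [cite: Harvey2009, §3.1] -/
def iAt (d : SideCtx) (wi π : ℕ) : ℕ := bigDigit wi (getD2 d.Itab d.R (π / d.G)) (π % d.G)

/-- Recorded second index of the entry at stream position `π`. [cite: Harvey2009, §3.1] -/
def jAt (d : SideCtx) (wi π : ℕ) : ℕ := bigDigit wi (getD2 d.Jtab d.R (π / d.G)) (π % d.G)

end SideCtx

/-- Side conditions of ONE entry at stream position `π`. A Gram entry: `i ≤ j < s`, the position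
table at `(i, j)` and the index tables at `π` agree with the entry, and twin closeness holds against
BOTH twin digits `M_ij` and `M_ji` (so no symmetry of the twin is assumed). A table entry: the index
table at `π` holds an out-of-range first index (`≥ s`), so that no pair can point at it.
[cite: BlekhermanParriloThomas2012, §3.1.4 eq. (3.12), p. 64] -/
def sideEntry (c : GramCtx) (d : SideCtx) (π : ℕ) : Entry → Bool
  | Entry.tab _ => decide (c.s ≤ d.iAt c.wi π)
  | Entry.gram i j sg mag =>
    decide (i ≤ j) && decide (j < c.s) && (d.posAt i j == π) && (d.iAt c.wi π == i) &&
      (d.jAt c.wi π == j) && closeN d.S d.L d.s₂ d.e (2 ^ (d.wm - 1)) (i == j) sg mag (d.mAt i j) &&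
      closeN d.S d.L d.s₂ d.e (2 ^ (d.wm - 1)) (i == j) sg mag (d.mAt j i)

/-- Side pass over decoded entries from position `π` on. [folklore] -/
def sideList (c : GramCtx) (d : SideCtx) : ℕ → List Entry → Bool
  | _, [] => true
  | π, en :: rest => sideEntry c d π en && sideList c d (π + 1) rest

/-- **The side pass** over a chunk list whose first entry has global position `π₀`. [folklore] -/
def sidePass (c : GramCtx) (d : SideCtx) (π₀ : ℕ) (chunks : List (ℕ × ℕ)) : Bool :=
  sideList c d π₀ (entries c chunks)

/-! ### The pair pass (every pair has an entry) -/

/-- Pairs `(i, j), (i, j+1), …, (i, s-1)` (fuel `k`): the position table points below `P` at an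
entry whose index tables read `(i, j)`. [folklore] -/
def pairRow (c : GramCtx) (d : SideCtx) (P i : ℕ) : ℕ → ℕ → Bool
  | 0, _ => true
  | k + 1, j =>
    let π := d.posAt i j
    decide (π < P) && (d.iAt c.wi π == i) && (d.jAt c.wi π == j) && pairRow c d P i k (j + 1)

/-- Rows `i, i+1, …` (fuel `k`), each from its diagonal on. [folklore] -/
def pairRows (c : GramCtx) (d : SideCtx) (P : ℕ) : ℕ → ℕ → Bool
  | 0, _ => true
  | k + 1, i => pairRow c d P i (c.s - i) i && pairRows c d P k (i + 1)

/-- **The pair pass**: all pairs `i ≤ j < s`; `P` = total number of stream entries. [folklore] -/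
def pairPass (c : GramCtx) (d : SideCtx) (P : ℕ) : Bool :=
  pairRows c d P c.s 0

end Keyed

end SOS

end Literature.Computation.Certificates
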